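import Literature.IUT.LogThetaLattice.ThetaPilotObjectsRoot
import Literature.IUT.LogThetaLattice.GlobalFrobenioidModelsLogVolume
import Literature.IUT.LogThetaLattice.GlobalFrobenioidModelsCategory
import Literature.IUT.LogVolume.RArithmeticDivisorsBridge
import HarnessLib

/-!
# [IUTchIII] Proposition 3.7 (v) at the model of record, A: the realified product embedding, the realification
# `ℤ ↦ ℝ` of exponent families, and the `Π_j (†𝓕⊛_𝔪𝔬𝔡)_j`-incarnation of the object-forming algorithm
# (abc-iut cell, layer L6, §F row F10-c; sequel of abc-iut-L6-t4's `ThetaPilotObjectsRoot.lean`)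

S. Mochizuki, *Inter-universal Teichmüller theory III*, kurims manuscript (May 2020), §3, Proposition 3.7
(v) "(Realified Product Embeddings and Non-realified Global Frobenioids)", p. 111 l. 41 – p. 112 l. 22
[claim: Mochizuki2012, status: disputed], read on the page (own render `paper:url-4b091feeb646` p0111–p0112):
"The constructions of `𝒞^⊩_LGP(†𝓗𝓣^{Θ±ell}NF)`, `𝒞^⊩_lgp(†𝓗𝓣^{Θ±ell}NF)` given in (iii) and (iv) above give
rise to a commutative diagram of categories [`𝒞^⊩_LGP ↪ Π_{j∈𝔽_l^⋇} (†𝓕⊛ℝ_MOD)_j` over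
`𝒞^⊩_lgp ↪ Π_{j∈𝔽_l^⋇} (†𝓕⊛ℝ_𝔪𝔬𝔡)_j`] — where the horizontal arrows are embeddings that arise tautologically from
the constructions of (iii) and (iv) [cf. [IUTchII], Remark 4.8.1, (i)]; the vertical arrows are
isomorphisms … In particular, by applying the definition of `(†𝓕⊛_𝔪𝔬𝔡)_j` — i.e., in terms of local
fractional ideals [cf. (ii)] — together with the products of realification functors
`Π_j (†𝓕⊛_𝔪𝔬𝔡)_j → Π_j (†𝓕⊛ℝ_𝔪𝔬𝔡)_j` [cf. [FrdI], Proposition 5.3], one obtains an algorithm for constructing,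
in a fashion compatible [in the evident sense] with the local isomorphisms `{†ρ_{lgp,v}}_{v∈𝕍}`,
`{†ρ_{LGP,v}}_{v∈𝕍}` of (iii) and (iv), objects of the [global!] categories `𝒞^⊩_lgp(†𝓗𝓣^{Θ±ell}NF)`,
`𝒞^⊩_LGP(†𝓗𝓣^{Θ±ell}NF)` from the local fractional ideals generated by elements of the monoids [cf. (iv);
Proposition 3.4, (ii)] `Ψ_{𝓕_lgp}(†𝓗𝓣^{Θ±ell}NF)_v` for `v ∈ 𝕍^bad`." (There is NO "Remark 3.7.1" in [IUTchIII]: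
in the kurims text the proof of Prop. 3.7, p. 112 l. 23–24, is followed directly by Definition 3.8.)

WHAT THIS FILE ADDS. abc-iut-L6-t4's statement file types Prop. 3.7 as the OUTPUT SIGNATURE
`GlobalLGPFrobenioidSignature` (`ThetaPilotObjects.lean`); its companions give the DUPUY–HILADO inhabitant in
which every Frobenioid is replaced by a group of `ℝ`-divisors, the realified product embeddings of (v) are the
IDENTITY and `objOfFrak = objOfLgp` (`divisorSignatureRoot`, `ThetaPilotObjectsDivisorSignature.lean`). Here
(v) is carried out one level up, at the MODEL OF RECORD of the Frobenioid `(†𝓕⊛_𝔪𝔬𝔡)_j` — abc-iut-L6-t4's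
Example 3.6 (ii) objects `GlobalFrobenioidModels.FrakObj` over abc-iut-L6-d1's model data (`ModelPlaces F` =
all places, `Γ_v = ℝ ⊇ ℝ_{≥0}`, `β_v = ord_v` / `−log|·|_v`; `GlobalFrobenioidModelsPlaces.lean`), i.e.
abc-iut-L6-d3's `ModelFrakObj F` (`GlobalFrobenioidModelsLogVolume.lean`, with its arithmetic divisor
`frakDivisor`, degree `frakDeg` and the Proposition 3.9 (iii) identity `globalLogVolume_frakRegion`):

* `ofLgpDivisor` — the realified product embedding of (v) at this model: lgp-divisors (abc-iut-c312-3's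
  `LgpDivisor`, the objects of `†𝒞^⊩_lgp`/`†𝒞^⊩_LGP` at the Dupuy–Hilado level) `↪` families of
  `𝓕⊛_𝔪𝔬𝔡`-objects, INJECTIVE and NOT the identity (`ofLgpDivisor_injective`), with its junction to abc-iut-L6-d3's
  divisor / degree / log-volume: `frakDivisor (ofFinDivisorFrak D) = −ofFinDivisor D`, `frakDeg = −deĝ_F`,
  `μ^log = −deĝ_F` (Prop. 3.9 (iii) at the model);
* `realifyExponents` — [FrdI] Prop. 5.3's realification ON DIVISOR MONOIDS at the finite places: an exponent
  family `(n_v) ∈ ⊕_{v∤∞} ℤ·[v]` (an honest fractional ideal `Π 𝔭_v^{n_v}` of `𝒪_F`) `↦` the same family with real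
  coefficients (injective, additive);
* `idealExponents X g` — the printed algorithm of (v) at the `ℤ`-level: from a collection
  `g = (g_{v,j})_{v ∈ 𝕍^bad, j ∈ 𝔽_l^⋇}` of elements of the monoids at the bad places (`g_{v,j} ∈ F_vˣ`), the
  exponents `n_{v,j} = ord_v(g_{v,j})` of "the local fractional ideals generated by" the `g_{v,j}`, trivial outside
  `𝕍^bad`; `objOfFrakModel X g` — the resulting object of `Π_j (†𝓕⊛_𝔪𝔬𝔡)_j` at the model of record (trivial at the
  archimedean places); `objOfMODModel X g` — its `Π_j (†𝓕⊛_MOD)_j`-incarnation through abc-iut-L6-t4's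
  Example 3.6 (iii) identification `FrakObj.toMOD`;
* THE SQUARE OF (v) READ ON OBJECTS: `realifyExponents (idealExponents X g j) = thetaObjOfRoot X g j`
  (`realifyExponents_idealExponents`: abc-iut-L6-t4's ROOT-convention lgp-object IS the realification of the
  ideal object) and `ofLgpDivisor (thetaObjOfRoot X g) = objOfFrakModel X g` (`square_objOfFrakModel`); the
  junctions `frakDivisor (objOfFrakModel X g j) = −ofFinDivisor (thetaObjOfRoot X g j)`,
  `frakDeg (objOfFrakModel X g j) = −deĝ_F(thetaObjOfRoot X g j) = μ^log(objOfFrakModel X g j)`.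
The companion `ThetaPilotObjectsFrakSignature.lean` assembles the `GlobalLGPFrobenioidSignature` inhabitant
`frakSignatureRoot` and identifies its Θ-pilot object (Def. 3.8 (i)) with the ideal family `(𝔮̲_v^{j²})`.

HONEST FRAMING. (1) At abc-iut-L6-d1's model `Γ_v = ℝ` the objects of `(†𝓕⊛_𝔪𝔬𝔡)_j` already carry real
classes, so the realification functor of [FrdI] Prop. 5.3 is invisible ON OBJECTS of the model; what (v) calls
"local fractional ideals" is recorded by the `ℤ`-valued `idealExponents` and the realification `realifyExponents`
of exponent families, through which `objOfFrakModel` is DEFINED. (2) NOT done here (residual, named): the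
CATEGORY-level square of (v) (the embeddings as functors on abc-iut-L6-t6's `FrakCat` / the model Frobenioid of
[FrdI] Thm. 5.2, and [FrdI] Prop. 5.3's realification FUNCTOR = layer L1's `Realification`), and the
compatibility "with the local isomorphisms `†ρ_{lgp,v}`" of the `𝓕^⊩`-prime-strip (abc-iut-L5-t2's
`InitialThetaData.rho`, [IUTchI] Ex. 3.5 — a different parametrisation of the places); at the level typed here
the `v`-component of the global object IS the exponent of the local ideal (`idealExponents_apply_of_mem`,
`frakDivisor_objOfFrakModel_inr`). Nothing here asserts a disputed claim or takes a side on [IUTchIII] Cor. 3.12;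
typed ≠ discharged; instantiated ≠ endorsed.
-/

noncomputable section

namespace Literature.IUT.LogThetaLattice

open Literature.IUT.HodgeArakelov Literature.IUT.LogVolume NumberField IsDedekindDomain
open Literature.IUT.LogThetaLattice.GlobalFrobenioidModels
open Literature.NumberTheory.EllipticCurves

/-! ### §1 The realified product embedding at the model: lgp-divisors ↪ families of `𝓕⊛_𝔪𝔬𝔡`-objects -/

section Embedding

variable {F : Type} [Field F] [NumberField F]

/-- A divisor `D = Σ a_v[v]` supported on the finite places, READ AS an object of the model Frobenioid
`𝓕⊛_𝔪𝔬𝔡` ([IUTchIII] Ex. 3.6 (ii); abc-iut-L6-t4, -d1, -d3's `ModelFrakObj`): the family of "fractional ideals"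
`𝔍_v = λ_v·𝒪_{K_v}` with class `[λ_v] = a_v` at finite `v` and the trivial ideal at every archimedean place
(the realified product embedding of Prop. 3.7 (v) on one factor `j`). [claim: Mochizuki2012, status: disputed] -/
def ofFinDivisorFrak (D : FinDivisor F) : ModelFrakObj F where
  cls := Sum.elim (fun w => D w) fun _ => 0
  finite := by
    refine (D.support.finite_toSet.image Sum.inl).subset ?_
    rintro (w | v) h
    · exact ⟨w, by simpa [Finsupp.mem_support_iff] using h, rfl⟩
    · exact absurd rfl h

/-- Classes of `ofFinDivisorFrak D` at finite places. [claim: Mochizuki2012, status: disputed] -/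
@[simp] theorem ofFinDivisorFrak_cls_inl (D : FinDivisor F) (w : HeightOneSpectrum (𝓞 F)) :
    (ofFinDivisorFrak D).cls (Sum.inl w) = D w := rfl

/-- Classes of `ofFinDivisorFrak D` at archimedean places are trivial. [claim: Mochizuki2012, status: disputed] -/
@[simp] theorem ofFinDivisorFrak_cls_inr (D : FinDivisor F) (v : InfinitePlace F) :
    (ofFinDivisorFrak D).cls (Sum.inr v) = 0 := rfl

/-- `ofFinDivisorFrak` is injective ("the horizontal arrows are embeddings", Prop. 3.7 (v), one factor).
[claim: Mochizuki2012, status: disputed] -/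
theorem ofFinDivisorFrak_injective : Function.Injective (ofFinDivisorFrak (F := F)) := by
  intro D D' h
  ext w
  have := congrArg (fun J : ModelFrakObj F => J.cls (Sum.inl w)) h
  simpa using this

/-- `ofFinDivisorFrak` is additive (tensor product of fractional-ideal families = sum of divisors).
[claim: Mochizuki2012, status: disputed] -/
theorem ofFinDivisorFrak_add (D D' : FinDivisor F) :
    ofFinDivisorFrak (D + D') = ofFinDivisorFrak D + ofFinDivisorFrak D' :=
  FrakObj.ext_cls <| funext fun p => by
    rcases p with w | v
    · rfl
    · change (0 : ℝ) = 0 + 0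
      rw [add_zero]

/-- **The realified product embedding of Prop. 3.7 (v) at the model**: an lgp-divisor `P = (P_j)_{j ∈ 𝔽_l^⋇}`
(an object of `†𝒞^⊩_lgp` / `†𝒞^⊩_LGP` at the Dupuy–Hilado level, abc-iut-c312-3's `LgpDivisor`) `↦` the family
`(ofFinDivisorFrak P_j)_j` of objects of `Π_j (†𝓕⊛_𝔪𝔬𝔡)_j`. [claim: Mochizuki2012, status: disputed] -/
def ofLgpDivisor {r : ℕ} (P : LgpDivisor F r) : Fin r → ModelFrakObj F := fun j => ofFinDivisorFrak (P j)

/-- `ofLgpDivisor` is injective ("embeddings", Prop. 3.7 (v); [IUTchII] Rmk. 4.8.1 (i)).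
[claim: Mochizuki2012, status: disputed] -/
theorem ofLgpDivisor_injective {r : ℕ} : Function.Injective (ofLgpDivisor (F := F) (r := r)) := by
  intro P P' h
  funext j
  exact ofFinDivisorFrak_injective (congrFun h j)

/-- The embedding is NOT the identity of abc-iut-L6-t4's Dupuy–Hilado reading: it changes the carrier
(`ℝ`-divisors on finite places ↦ class families on ALL places); e.g. `ofLgpDivisor 0 j` is the trivial family.
[claim: Mochizuki2012, status: disputed] -/
theorem ofLgpDivisor_zero {r : ℕ} (j : Fin r) : ofLgpDivisor (F := F) (0 : LgpDivisor F r) j = 0 :=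
  FrakObj.ext_cls <| funext fun p => by rcases p with w | v <;> rfl

/-! #### Junction with abc-iut-L6-d3's divisor, degree and log-volume of `𝓕⊛_𝔪𝔬𝔡`-objects -/

/-- The arithmetic divisor "determined by `𝔍`" (abc-iut-L6-d3's `frakDivisor`: the divisor of the line bundle
`𝒪(−D)`) of the embedded object is `−D` extended by zero at the archimedean places.
[claim: Mochizuki2012, status: disputed] -/
theorem frakDivisor_ofFinDivisorFrak (D : FinDivisor F) :
    frakDivisor (ofFinDivisorFrak D) = -ADivisor.ofFinDivisor F D := by
  ext p
  rw [frakDivisor_apply, Finsupp.neg_apply]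
  rcases p with v | w
  · rw [ADivisor.ofFinDivisor_apply_inl, Sum.swap_inl, ofFinDivisorFrak_cls_inr, mul_zero]
  · rw [ADivisor.ofFinDivisor_apply_inr, Sum.swap_inr, ofFinDivisorFrak_cls_inl, placeMult_inr, one_mul]

/-- The degree of the embedded object is `−deĝ_F(D)` (abc-iut-c312-3's finite-place Arakelov degree).
[claim: Mochizuki2012, status: disputed] -/
theorem frakDeg_ofFinDivisorFrak (D : FinDivisor F) : frakDeg (ofFinDivisorFrak D) = -FinDivisor.deg F D := by
  rw [frakDeg, frakDivisor_ofFinDivisorFrak, map_neg, degF_ofFinDivisor]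

/-- **[IUTchIII] Prop. 3.9 (iii) at the model for the embedded objects**: the global log-volume of the region
of `ofFinDivisorFrak D` is `−deĝ_F(D)` (abc-iut-L6-d3's `globalLogVolume_frakRegion`).
[claim: Mochizuki2012, status: disputed] -/
theorem globalLogVolume_frakRegion_ofFinDivisorFrak (D : FinDivisor F) :
    globalLogVolume (divisorLogVolume F) (frakRegion (ofFinDivisorFrak D)) = -FinDivisor.deg F D := by
  rw [globalLogVolume_frakRegion, frakDeg_ofFinDivisorFrak]

/-! #### [FrdI] Prop. 5.3 on divisor monoids: the realification `ℤ ↦ ℝ` of exponent families -/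

/-- The REALIFICATION of an exponent family `(n_v)_v ∈ Div(F)_0 = ⊕_{v ∤ ∞} ℤ·[v]` (a fractional ideal
`Π 𝔭_v^{n_v}` of `𝒪_F`): the same family with real coefficients, `Div(F)_0 → Div(F)_0 ⊗ ℝ` ([FrdI] Prop. 5.3,
"realification functors" of [IUTchIII] Prop. 3.7 (v), read on divisor monoids at the finite places).
[claim: Mochizuki2012, status: disputed] -/
def realifyExponents : (HeightOneSpectrum (𝓞 F) →₀ ℤ) →+ FinDivisor F :=
  Finsupp.mapRange.addMonoidHom (Int.castAddHom ℝ)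

omit [NumberField F] in
/-- Coefficients of the realification. [claim: Mochizuki2012, status: disputed] -/
@[simp] theorem realifyExponents_apply (N : HeightOneSpectrum (𝓞 F) →₀ ℤ) (w : HeightOneSpectrum (𝓞 F)) :
    realifyExponents N w = (N w : ℝ) := rfl

omit [NumberField F] in
/-- Realification of a single prime power `𝔭_v^{n}`: `n·[v]`. [claim: Mochizuki2012, status: disputed] -/
theorem realifyExponents_single (v : HeightOneSpectrum (𝓞 F)) (n : ℤ) :
    realifyExponents (Finsupp.single v n) = FinDivisor.of v (n : ℝ) := by
  ext w
  rw [realifyExponents_apply]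
  by_cases h : w = v
  · subst h
    rw [Finsupp.single_eq_same, Finsupp.single_eq_same]
  · rw [Finsupp.single_eq_of_ne h, Finsupp.single_eq_of_ne h, Int.cast_zero]

omit [NumberField F] in
/-- The realification `Div(F)_0 → Div(F)_0 ⊗ ℝ` is injective. [claim: Mochizuki2012, status: disputed] -/
theorem realifyExponents_injective : Function.Injective (realifyExponents (F := F)) := by
  intro N N' h
  ext w
  have := congrArg (fun D : FinDivisor F => D w) h
  simpa using this

end Embedding

/-! ### §2 Prop. 3.7 (v): the object-forming algorithm from the local fractional ideals at `v ∈ 𝕍^bad` -/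

section ObjectForming

variable {F : Type} [Field F] [NumberField F] (X : PilotData F)

/-- **[IUTchIII] Prop. 3.7 (v), the object-forming algorithm at the `ℤ`-level**: a collection
`g = (g_{v,j})_{v ∈ 𝕍^bad, j ∈ 𝔽_l^⋇}` of elements of the monoids at the bad places (`g_{v,j} ∈ F_vˣ`) determines, for
each `j`, the exponent family `Σ_{v ∈ 𝕍^bad} ord_v(g_{v,j})·[v]` of "the local fractional ideals generated by elements
of the monoids … for `v ∈ 𝕍^bad`" (abc-iut-c312-3's `CompletionModel.ordv`; the trivial ideal at every other
place). [claim: Mochizuki2012, status: disputed] -/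
def idealExponents (g : ∀ v ∈ X.S, Fin X.lstar → (v.adicCompletion F)ˣ) (i : Fin X.lstar) :
    HeightOneSpectrum (𝓞 F) →₀ ℤ :=
  ∑ v ∈ X.S.attach, Finsupp.single v.1 (CompletionModel.ordv F v.1 (g v.1 v.2 i))

variable (g : ∀ v ∈ X.S, Fin X.lstar → (v.adicCompletion F)ˣ) (i : Fin X.lstar)

/-- The exponent at a bad place is `ord_v(g_{v,j})` ("compatible … with the local isomorphisms": the
`v`-component of the global object is the class of the local fractional ideal). [claim: Mochizuki2012, status: disputed] -/
theorem idealExponents_apply_of_mem {w : HeightOneSpectrum (𝓞 F)} (hw : w ∈ X.S) :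
    idealExponents X g i w = CompletionModel.ordv F w (g w hw i) := by
  unfold idealExponents
  rw [Finsupp.finsetSum_apply, Finset.sum_eq_single ⟨w, hw⟩]
  · exact Finsupp.single_eq_same
  · intro v _ hv
    exact Finsupp.single_eq_of_ne fun h => hv (Subtype.ext h.symm)
  · intro h
    exact absurd (Finset.mem_attach _ _) h

/-- The exponent at a finite place outside `𝕍^bad` is `0`. [claim: Mochizuki2012, status: disputed] -/
theorem idealExponents_apply_of_not_mem {w : HeightOneSpectrum (𝓞 F)} (hw : w ∉ X.S) :
    idealExponents X g i w = 0 := by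
  unfold idealExponents
  rw [Finsupp.finsetSum_apply]
  refine Finset.sum_eq_zero fun v _ => Finsupp.single_eq_of_ne ?_
  rintro rfl
  exact hw v.2

/-- **The realification of the ideal object IS abc-iut-L6-t4's lgp-object** (ROOT convention): "together with the
products of realification functors … [cf. [FrdI], Proposition 5.3]" — `realifyExponents (idealExponents X g j)
= thetaObjOfRoot X g j`. [claim: Mochizuki2012, status: disputed] -/
theorem realifyExponents_idealExponents : realifyExponents (idealExponents X g i) = thetaObjOfRoot X g i := by
  unfold idealExponents thetaObjOfRoot
  rw [map_sum]
  exact Finset.sum_congr rfl fun v _ => realifyExponents_single _ _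

/-- **[IUTchIII] Prop. 3.7 (v), the `Π_j (†𝓕⊛_𝔪𝔬𝔡)_j`-incarnation of the object-forming algorithm** at the model of
record: the object `{𝔍_v}_v` of `(†𝓕⊛_𝔪𝔬𝔡)_j` whose local fractional ideal at `v ∈ 𝕍^bad` is the one generated by
`g_{v,j}` and which is trivial at every other place (realification of `idealExponents`, embedded).
[claim: Mochizuki2012, status: disputed] -/
def objOfFrakModel : ModelFrakObj F := ofFinDivisorFrak (realifyExponents (idealExponents X g i))

/-- INTEGRALITY: the class of `objOfFrakModel X g j` at a finite place is the INTEGER `idealExponents X g j w`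
(an honest power of the maximal ideal, although the model of record has `Γ_v = ℝ`).
[claim: Mochizuki2012, status: disputed] -/
theorem objOfFrakModel_cls_inl (w : HeightOneSpectrum (𝓞 F)) :
    (objOfFrakModel X g i).cls (Sum.inl w) = (idealExponents X g i w : ℝ) := rfl

/-- The object is trivial at the archimedean places. [claim: Mochizuki2012, status: disputed] -/
@[simp] theorem objOfFrakModel_cls_inr (v : InfinitePlace F) : (objOfFrakModel X g i).cls (Sum.inr v) = 0 :=
  rfl

/-- **THE SQUARE OF PROP. 3.7 (v) ON OBJECTS**: the realified product embedding applied to the lgp-object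
formed from `g` IS the `𝔪𝔬𝔡`-object formed from the local fractional ideals generated by `g`.
[claim: Mochizuki2012, status: disputed] -/
theorem square_objOfFrakModel : ofLgpDivisor (thetaObjOfRoot X g) = objOfFrakModel X g := by
  funext j
  change ofFinDivisorFrak _ = ofFinDivisorFrak _
  rw [realifyExponents_idealExponents]

/-- **The `Π_j (†𝓕⊛_MOD)_j`-incarnation** of the same object (Prop. 3.7 (v) "objects of … `𝒞^⊩_LGP`"; Def. 3.8 (i)
"the object of `Π_j (†𝓕⊛_MOD)_j` or `Π_j (†𝓕⊛_𝔪𝔬𝔡)_j`"): transport along abc-iut-L6-t4's Example 3.6 (iii)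
identification `FrakObj.toMOD` (the trivial `F^×`-torsor, integral structure modified as prescribed by the
ideals). [claim: Mochizuki2012, status: disputed] -/
abbrev objOfMODModel : MODObj F (ModelPlaces F) (fun _ => ℝ) betaModel :=
  (objOfFrakModel X g i).toMOD (F := F) (β := betaModel)

/-- The local trivializations of the `MOD`-incarnation: `t_v(x) = β_v(x) − [𝔍_v]`.
[claim: Mochizuki2012, status: disputed] -/
theorem objOfMODModel_t (p : ModelPlaces F) (x : Additive Fˣ) :
    (objOfMODModel X g i).t p x = betaModel p x - (objOfFrakModel X g i).cls p :=
  rfl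

/-- The arithmetic divisor of the `𝔪𝔬𝔡`-object formed from `g` is `−P` extended by zero,
`P = thetaObjOfRoot X g j`. [claim: Mochizuki2012, status: disputed] -/
theorem frakDivisor_objOfFrakModel :
    frakDivisor (objOfFrakModel X g i) = -ADivisor.ofFinDivisor F (thetaObjOfRoot X g i) := by
  rw [objOfFrakModel, realifyExponents_idealExponents]
  exact frakDivisor_ofFinDivisorFrak _

/-- "Compatible … with the local isomorphisms": the finite `v`-coefficient of the arithmetic divisor of the
global object is minus the exponent `ord_v(g_{v,j})` of the local fractional ideal at `v ∈ 𝕍^bad`.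
[claim: Mochizuki2012, status: disputed] -/
theorem frakDivisor_objOfFrakModel_inr {w : HeightOneSpectrum (𝓞 F)} (hw : w ∈ X.S) :
    frakDivisor (objOfFrakModel X g i) (Sum.inr w) = -(CompletionModel.ordv F w (g w hw i) : ℝ) := by
  rw [frakDivisor_objOfFrakModel, Finsupp.neg_apply, ADivisor.ofFinDivisor_apply_inr,
    ← realifyExponents_idealExponents, realifyExponents_apply, idealExponents_apply_of_mem X g i hw]

/-- The degree of the `𝔪𝔬𝔡`-object formed from `g`: `−deĝ_F(thetaObjOfRoot X g j)`.
[claim: Mochizuki2012, status: disputed] -/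
theorem frakDeg_objOfFrakModel : frakDeg (objOfFrakModel X g i) = -FinDivisor.deg F (thetaObjOfRoot X g i) := by
  rw [objOfFrakModel, realifyExponents_idealExponents]
  exact frakDeg_ofFinDivisorFrak _

/-- **Prop. 3.9 (iii) for the objects of Prop. 3.7 (v)**: the global log-volume of the `𝔪𝔬𝔡`-object formed from
`g` is `−deĝ_F(thetaObjOfRoot X g j)`. [claim: Mochizuki2012, status: disputed] -/
theorem globalLogVolume_objOfFrakModel :
    globalLogVolume (divisorLogVolume F) (frakRegion (objOfFrakModel X g i)) =
      -FinDivisor.deg F (thetaObjOfRoot X g i) := by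
  rw [objOfFrakModel, realifyExponents_idealExponents]
  exact globalLogVolume_frakRegion_ofFinDivisorFrak _

end ObjectForming

end Literature.IUT.LogThetaLattice
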